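import Literature.MathematicalPhysics.QuantumFieldTheory.Balaban1983to89.Node00.Record13
import Literature.MathematicalPhysics.QuantumFieldTheory.Balaban1983to89.Node00.Record12BgRowCoClassGauge
import Literature.MathematicalPhysics.QuantumFieldTheory.Balaban1983to89.Node00.TorusCoverGaugeTokensR

/-!
# NODE 00 — ROW P11, THE R-PORT OF THE GAUGE SENTENCE: [15] THEOREM 1 (9) LINE 1 IN ∃-GAUGE FORM WITH dag-n07-e's SEPARATION FLOOR `c ≤ ν.M₁` DISPLAYED —
# `VariationalThm1GaugeRegSepTop7MR F N Sup M c B₃ B₃' a₀ a₁` ∕ `VariationalThm1GaugeRegSepCoP7MR F N M c B₃ B₃' a₀ a₁`, the row body keyed on them, the supplier from the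
# floor-carrying STEP fact `Gauge9RegSepTopStepR`, and the Stage-13 lift with `hc : c ≤ θ.ν.M₁` (plan g75's (β), dag-lead WORDS-145 (A))

Cell `pub-ymgap`, seat `pub-ymgap-dag-n21-c` (g11) — pen (β) by dag-lead WORDS-145 (A) (INBOX l.21392; dag-n07-e g10 ■ CLOSED without taking it), FILE B′ of the
sequence A → B′ → B.  NEW leaf; node00-def-P11's FILE 14 `Record12BgRowCoClassGauge` (p534358: `Sect2.LocalGaugeOn`, `VariationalThm1GaugeRegSep{Top7M,CoP7M}`,
`bgRowAtDatumU_of_classBoundsPos_of_localGauge`, `gaugeLetter_of_numerics`), node00-def-K0a's FILE 21 `Record13SepCoPInhabitedOfThm1CoPGauge` (`Stage13Params.bgAtDatumCoP_…`)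
and dag-n07-e's FILE 29 `TorusCoverGaugeTokensR` (p546637: `Gauge9RegSepTopStepR`) CONSUMED BY NAME, nothing modified.  `--kind definition --supports stmt-QuantumFields-20541`.
[15] = [Balaban1985Variational]; [6] = [Balaban1985RegularSpaces]; [III] = [Balaban1988Convergent]; [I] = [Balaban1987RG1]; [IV] = [Balaban1989LargeFieldI].

WHY.  dag-n07-e's road to the (9)-step goes through [6] Prop. 6 at NODE 00's cube member, whose collared cube must fit print's separation layer: the landed R-twins
`Gauge152OfClassTopStepR ∕ Gauge9RegSepTopStepR F N Sup M c …` carry ONE more binder `c ≤ ν.M₁` right after `0 < ν.M₁` (`gauge152R_of_prop6` supplies `c = (11·4 + 3·L)·L`).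
Every consumer of the (9) sentence on the K0 road — FILE 14's `localGaugeOn_of_thm1GaugeRegSepTop7M` (the ONE place `h15G` is applied, at a given `ν`), its two composites, and
FILE 21 §2's Stage-13 lift — must therefore thread the floor: this file is those declarations' TWINS with the extra binder `(hc : c ≤ ν.M₁)` (bodies byte-identical otherwise),
plus the Thm-1-level R-token they key on and its supplier from the R step fact (minimal ⇒ critical, FILE 14 §4's pattern).  The collared witness meeting `hc` is FILE A
(`theta13OfThm1CCM`, `ν.M₁ = L^j`); the closers are FILE B.

CONTENTS.  §1 ★★ `VariationalThm1GaugeRegSepTop7MR` (def: FILE 14 §1's text with `c ≤ ν.M₁ →` after `0 < ν.M₁ →`; binder order `hsep hM₁ hc` as in FILE 29), `.of_le`, `.mono`,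
`.mono_floor`, `VariationalThm1GaugeRegSepTop7M.toR` (old ⇒ new).  §2 `localGaugeOn_of_thm1GaugeRegSepTop7MR` (twin of :335), ★★★ `bgRowAtDatumU_of_thm1RegSepTop7M_of_thm1GaugeR`
(twin of :363).  §3 ★★ `VariationalThm1GaugeRegSepCoP7MR` (def, `Sup := suppDomOfRecord`), `.toTop7MR` ∕ `….toCoP7MR`, `.of_le`, `.mono`, `.mono_floor`, `VariationalThm1GaugeRegSepCoP7M.toR`,
`localGaugeOn_UbgMSCoPOfRecord_of_thm1GaugeRegSepCoP7MR` (twin of :445), ★★★ `bgRowAtDatumCoP_of_thm1RegSepCoP7M_of_thm1GaugeR` (twin of :472).  §4 ★ `variationalThm1GaugeRegSepTop7MR_of_gauge9TopStepR`,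
★ `variationalThm1GaugeRegSepCoP7MR_of_gauge9TopStepR` (twins of :513∕:523 on `Gauge9RegSepTopStepR`).  §5 ★ `Stage13Params.bgAtDatumCoP_of_thm1RegSepCoP7M_of_thm1GaugeR`
(twin of FILE 21 :113 with `(hc : c ≤ θ.ν.M₁)`).

HONEST FRAMING.  Hypothesis threading around two NAMED FACTS (`Prop`s with parameters, NEVER asserted) + bookkeeping; nothing of Bałaban asserted or discharged; K0⁷ NOT closed;
counts unmoved (typed 28∕28 · discharged 5∕27); one finite `𝕋⁴` family at fixed `ε` — NOT continuum ∕ OS ∕ mass gap ∕ Clay.  Two `def`s, no `instance`, no `notation`, no `sorry`.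
-/

noncomputable section

open MeasureTheory
open scoped Matrix.Norms.L2Operator

namespace Literature.MathematicalPhysics.QuantumFieldTheory.Balaban1983to89.Node00

open T4Continuum B14.Eq218Concrete B15DeterminingSets B12RegularSpaces111 B14RegularSpaces234 B14Radii T4AxialGaugeSmallField

/-! ## §1  The gauge sentence with the separation floor displayed — top-domain form -/

section NamedFactGaugeTopMR

variable (F : T4Family) (N : ℕ) [NeZero N]

/-- **★★ NAMED FACT, R-PORT — [15] THEOREM 1 (9) LINE 1, ∃-GAUGE FORM, OVER PRINT'S CLASS (6) ON THE SUPPORT `Ω₀ = Sup ν K s.Ω`, AT NUMERICS WITH `M₁ ≥ 1` AND THE SEPARATION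
FLOOR `c ≤ M₁`, CUBE LETTER `M`** (a `Prop` with parameters, NEVER asserted): node00-def-P11's `VariationalThm1GaugeRegSepTop7M F N Sup M B₃ B₃' a₀ a₁` (FILE 14 §1) VERBATIM with ONE
more hypothesis `c ≤ ν.M₁` right after `0 < ν.M₁` — the room [6] Prop. 6's collar `2R₁M₁Lʲη` needs inside print's separation layer ([6] (1.3)–(1.6): the layers are `M₁` blocks wide),
exactly as dag-n07-e's step facts `Gauge152OfClassTopStepR ∕ Gauge9RegSepTopStepR` carry it; `c` a PARAMETER like `M`.  HONEST LABEL and named absorptions: as FILE 14 §1.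
-- TODO(general form): as FILE 14 §1 (Hölder member and (10) not part of this sentence; ONE threshold ε₁ in print; general admissible `{Ω_j}`; print's `R ≥ R₁`, `M` a multiple of `R₁M₁`).
[cite: Balaban1985Variational, (1) p.277, Thm 1 (2),(3),(5),(6),(7),(9) pp.278–279, (144)–(152) pp.300–301; Balaban1985RegularSpaces, (1.3)–(1.9) p.77, Prop. 6 p.99; Balaban1988Convergent, (2.6)–(2.8) pp.255–256, (2.12)–(2.13) p.256, (2.27)–(2.28) p.259, (2.38) p.261; Balaban1987RG1, (1.12) p.262] -/
def VariationalThm1GaugeRegSepTop7MR (Sup : (ν : Stage7Numerics) → (K : ℕ) → (ℕ → Set (Site (F.P K) 0)) → Set (Site (F.P K) 0)) (M c : ℕ) (B₃ B₃' a₀ a₁ : ℝ) : Prop :=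
  ∀ (ν : Stage7Numerics) (g : ℕ → ℝ) (K k : ℕ) (s : SeqOfRecord F ν M g K k), Sect2.SeqSeparated ν.M₁ s → 0 < ν.M₁ → c ≤ ν.M₁ → ∀ (ε₀ : ℝ) (δ : ℕ → ℝ),
    (∀ n, n ≤ k → 0 < δ n ∧ δ n ≤ a₁ ∧ B₃ * δ n ≤ ε₀) → (∀ n, n < k → δ n ≤ 2 * δ (n + 1)) → (∀ n, n < k → δ (n + 1) ≤ 2 * δ n) → ε₀ ≤ a₀ →
    ∀ W : MSField (F.P K) (SU N), Sect2.DataSmall7PTop (avOfRecord F N K) s.Ω (Sup ν K s.Ω) k δ W →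
      ∀ U₀, IsMinimizer (avOfRecord F N K)
          {U | (∀ n, n ≤ k → PlaqSmallOn (Sect2.omegaPlaqsTop s.Ω (Sup ν K s.Ω) n) (ε₀ * (F.P K).eta n ^ 2) U) ∧
            Sect2.CoDivClassOnTop s.Ω (Sup ν K s.Ω) k ε₀ U} (genSet s.Ω k) W U₀ →
        ∀ n, 1 ≤ n → n ≤ k →
          (((B14.Eq213MaximalDomains.side (F.P K).L M n : ℕ) : ℤ) < (F.P K).sitesPerDir 0 →
            ∀ a ∈ cubeIndices (F.P K) (B14.Eq213MaximalDomains.side (F.P K).L M n),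
              cubeEnl (F.P K) (B14.Eq213MaximalDomains.side (F.P K).L M n) a 0 ⊆ s.Ω n →
              Sect2.LocalGaugeOn (cubeEnl (F.P K) (B14.Eq213MaximalDomains.side (F.P K).L M n) a 0) ((F.P K).eta n) (B₃' * δ n) U₀) ∧
          (((B14.Eq213MaximalDomains.side (F.P K).L M (n + 1) : ℕ) : ℤ) < (F.P K).sitesPerDir 0 →
            ∀ a ∈ cubeIndices (F.P K) (B14.Eq213MaximalDomains.side (F.P K).L M (n + 1)),
              cubeEnl (F.P K) (B14.Eq213MaximalDomains.side (F.P K).L M (n + 1)) a 0 ⊆ s.Ω n →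
              Sect2.LocalGaugeOn (cubeEnl (F.P K) (B14.Eq213MaximalDomains.side (F.P K).L M (n + 1)) a 0) ((F.P K).eta n) (B₃' * δ n) U₀)

variable {F N}

/-- OLD ⇒ NEW: the floor-free gauge sentence implies its floor-carrying twin for every floor `c`. [cite: Balaban1985Variational, Thm 1 (9) p.279 (bookkeeping)] -/
theorem VariationalThm1GaugeRegSepTop7M.toR {Sup : (ν : Stage7Numerics) → (K : ℕ) → (ℕ → Set (Site (F.P K) 0)) → Set (Site (F.P K) 0)} {M : ℕ} {B₃ B₃' a₀ a₁ : ℝ}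
    (h : VariationalThm1GaugeRegSepTop7M F N Sup M B₃ B₃' a₀ a₁) (c : ℕ) : VariationalThm1GaugeRegSepTop7MR F N Sup M c B₃ B₃' a₀ a₁ :=
  fun ν g K k s hsep hM₁ _ => h ν g K k s hsep hM₁

/-- The R gauge sentence is ANTITONE in `a₀`, `a₁`. [cite: Balaban1985Variational, Thm 1 p.279 (the range «ε₀ ≤ a₀», «ε₁ ≤ a₁»)] -/
theorem VariationalThm1GaugeRegSepTop7MR.of_le {Sup : (ν : Stage7Numerics) → (K : ℕ) → (ℕ → Set (Site (F.P K) 0)) → Set (Site (F.P K) 0)} {M c : ℕ} {B₃ B₃' a₀ a₀' a₁ a₁' : ℝ}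
    (h : VariationalThm1GaugeRegSepTop7MR F N Sup M c B₃ B₃' a₀ a₁) (ha₀ : a₀' ≤ a₀) (ha₁ : a₁' ≤ a₁) : VariationalThm1GaugeRegSepTop7MR F N Sup M c B₃ B₃' a₀' a₁' :=
  fun ν g K k s hsep hM₁ hc ε₀ δ hnum hcomp hcomp' hε W h7 U₀ hmin =>
    h ν g K k s hsep hM₁ hc ε₀ δ (fun n hn => ⟨(hnum n hn).1, (hnum n hn).2.1.trans ha₁, (hnum n hn).2.2⟩) hcomp hcomp' (hε.trans ha₀) W h7 U₀ hmin

/-- The R gauge sentence is MONOTONE in the gauge constant `B₃'`. [cite: Balaban1985Variational, Thm 1 (9) p.279 (bookkeeping)] -/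
theorem VariationalThm1GaugeRegSepTop7MR.mono {Sup : (ν : Stage7Numerics) → (K : ℕ) → (ℕ → Set (Site (F.P K) 0)) → Set (Site (F.P K) 0)} {M c : ℕ} {B₃ B₃' B₃'' a₀ a₁ : ℝ}
    (h : VariationalThm1GaugeRegSepTop7MR F N Sup M c B₃ B₃' a₀ a₁) (hB : B₃' ≤ B₃'') : VariationalThm1GaugeRegSepTop7MR F N Sup M c B₃ B₃'' a₀ a₁ := by
  intro ν g K k s hsep hM₁ hc ε₀ δ hnum hcomp hcomp' hε W h7 U₀ hmin n hn1 hnk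
  have hδ : B₃' * δ n ≤ B₃'' * δ n := mul_le_mul_of_nonneg_right hB (hnum n hnk).1.le
  obtain ⟨hMS, hI⟩ := h ν g K k s hsep hM₁ hc ε₀ δ hnum hcomp hcomp' hε W h7 U₀ hmin n hn1 hnk
  exact ⟨fun hsN a ha hΩ => (hMS hsN a ha hΩ).of_le hδ, fun hsN a ha hΩ => (hI hsN a ha hΩ).of_le hδ⟩

/-- The R gauge sentence is MONOTONE in the floor (a larger floor is a weaker sentence). [cite: Balaban1985RegularSpaces, (1.3)–(1.6) p.77 (bookkeeping)] -/
theorem VariationalThm1GaugeRegSepTop7MR.mono_floor {Sup : (ν : Stage7Numerics) → (K : ℕ) → (ℕ → Set (Site (F.P K) 0)) → Set (Site (F.P K) 0)} {M c c' : ℕ} {B₃ B₃' a₀ a₁ : ℝ}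
    (h : VariationalThm1GaugeRegSepTop7MR F N Sup M c B₃ B₃' a₀ a₁) (hc : c ≤ c') : VariationalThm1GaugeRegSepTop7MR F N Sup M c' B₃ B₃' a₀ a₁ :=
  fun ν g K k s hsep hM₁ hc' => h ν g K k s hsep hM₁ (hc.trans hc')

end NamedFactGaugeTopMR

/-! ## §2  ROW P11's body keyed on the R gauge sentence (FILE 14 §2's two theorems with the floor threaded) -/

section RowBodyGaugeR

variable {F : T4Family} {N : ℕ} [NeZero N]

/-- **★ EVERY MINIMISER OVER THE TOP-DOMAIN CLASS (6) AT NUMERICS MEETING THE FLOOR CARRIES THE LOCAL GAUGES OF (9) LINE 1 AT THRESHOLD `B₃'·cR·ε_n` ON BOTH CUBE FAMILIES INSIDE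
`Ω_n`, `1 ≤ n ≤ k`** — FILE 14's `localGaugeOn_of_thm1GaugeRegSepTop7M` with `(hc : c ≤ ν.M₁)`. [cite: Balaban1985Variational, Thm 1 (2),(6),(7),(9) pp.278–279; Balaban1985RegularSpaces, (1.3) p.77; Balaban1988Convergent, (2.6)–(2.8) pp.255–256, (2.12)–(2.13) p.256, (2.38) p.261] -/
theorem localGaugeOn_of_thm1GaugeRegSepTop7MR {Sup : (ν : Stage7Numerics) → (K : ℕ) → (ℕ → Set (Site (F.P K) 0)) → Set (Site (F.P K) 0)} {M c : ℕ} {B₃ B₃' a₀ a₁ : ℝ}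
    (h15G : VariationalThm1GaugeRegSepTop7MR F N Sup M c B₃ B₃' a₀ a₁) (ν : Stage7Numerics)
    (g : ℕ → ℝ) (K k : ℕ) (cR : ℝ) (s : SeqOfRecord F ν M g K k) (hsep : Sect2.SeqSeparated ν.M₁ s) (hM₁ : 0 < ν.M₁) (hc : c ≤ ν.M₁)
    (hnum : ∀ n, n ≤ k → 0 < cR * epsOfRecord ν g n ∧ cR * epsOfRecord ν g n ≤ a₁ ∧ B₃ * (cR * epsOfRecord ν g n) ≤ ν.εreg) (ha₀ : ν.εreg ≤ a₀)
    (hcomp : ∀ n, n < k → cR * epsOfRecord ν g n ≤ 2 * (cR * epsOfRecord ν g (n + 1)))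
    (hcomp' : ∀ n, n < k → cR * epsOfRecord ν g (n + 1) ≤ 2 * (cR * epsOfRecord ν g n))
    {W : MSField (F.P K) (SU N)} (h7 : Sect2.DataSmall7PTop (avOfRecord F N K) s.Ω (Sup ν K s.Ω) k (fun n => cR * epsOfRecord ν g n) W)
    {U₀ : GaugeField (F.P K) 0 (SU N)} (hmin : IsMinimizer (avOfRecord F N K)
      {U | (∀ n, n ≤ k → PlaqSmallOn (Sect2.omegaPlaqsTop s.Ω (Sup ν K s.Ω) n) (ν.εreg * (F.P K).eta n ^ 2) U) ∧
        Sect2.CoDivClassOnTop s.Ω (Sup ν K s.Ω) k ν.εreg U} (genSet s.Ω k) W U₀) :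
    ∀ n, 1 ≤ n → n ≤ k →
      (((B14.Eq213MaximalDomains.side (F.P K).L M n : ℕ) : ℤ) < (F.P K).sitesPerDir 0 →
        ∀ a ∈ cubeIndices (F.P K) (B14.Eq213MaximalDomains.side (F.P K).L M n),
          cubeEnl (F.P K) (B14.Eq213MaximalDomains.side (F.P K).L M n) a 0 ⊆ s.Ω n →
          Sect2.LocalGaugeOn (cubeEnl (F.P K) (B14.Eq213MaximalDomains.side (F.P K).L M n) a 0) ((F.P K).eta n) (B₃' * (cR * epsOfRecord ν g n)) U₀) ∧
      (((B14.Eq213MaximalDomains.side (F.P K).L M (n + 1) : ℕ) : ℤ) < (F.P K).sitesPerDir 0 →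
        ∀ a ∈ cubeIndices (F.P K) (B14.Eq213MaximalDomains.side (F.P K).L M (n + 1)),
          cubeEnl (F.P K) (B14.Eq213MaximalDomains.side (F.P K).L M (n + 1)) a 0 ⊆ s.Ω n →
          Sect2.LocalGaugeOn (cubeEnl (F.P K) (B14.Eq213MaximalDomains.side (F.P K).L M (n + 1)) a 0) ((F.P K).eta n) (B₃' * (cR * epsOfRecord ν g n)) U₀) :=
  h15G ν g K k s hsep hM₁ hc ν.εreg (fun n => cR * epsOfRecord ν g n) hnum hcomp hcomp' ha₀ W h7 U₀ hmin

/-- **★★★ ROW P11's BODY AT `(s, 𝐖)` FOR EVERY MINIMISER `U₀` OVER THE TOP-DOMAIN CLASS (6), FROM (8) `VariationalThm1RegSepTop7M` AND THE R GAUGE SENTENCE** — FILE 14's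
`bgRowAtDatumU_of_thm1RegSepTop7M_of_thm1Gauge` with `(hc : c ≤ ν.M₁)` threaded to the one application of `h15G`; everything else byte-identical (plaquette class bounds from (8),
handed-over gauges from (9) line 1, the numerics `hnum`∕`ha₀`∕`hBα`, two-sided comparability, (C1)(C2), the two radius letters, the non-wrapping letter `hsN`).
[cite: Balaban1985Variational, Thm 1 (2),(6)–(9) pp.278–279; Balaban1985RegularSpaces, (1.3)–(1.9) p.77; Balaban1988Convergent, (2.4)–(2.8) pp.255–256, (2.12)–(2.13) p.256, (2.27)–(2.28) p.259, (2.34)–(2.41) p.261; Balaban1987RG1, (1.11)–(1.16) p.262] -/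
theorem bgRowAtDatumU_of_thm1RegSepTop7M_of_thm1GaugeR {Sup : (ν : Stage7Numerics) → (K : ℕ) → (ℕ → Set (Site (F.P K) 0)) → Set (Site (F.P K) 0)} {M c : ℕ}
    {B₃ B₃' a₀ a₁ : ℝ} (h15 : VariationalThm1RegSepTop7M F N Sup B₃ a₀ a₁) (h15G : VariationalThm1GaugeRegSepTop7MR F N Sup M c B₃ B₃' a₀ a₁)
    (S : Sect2.Setting (MatA N) (SU N)) (hι : S.ι = ιSU N) (h𝓜 : S.𝓜 = B12RegularSpaces111SpecialUnitary.suModel N) (hS : S.Laws) (hpos : S.Pos)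
    (ν : Stage7Numerics) (hM : 0 < M) (K k : ℕ) (cR : ℝ)
    (hnum : ∀ n, n ≤ k → 0 < cR * epsOfRecord ν S.flow.g n ∧ cR * epsOfRecord ν S.flow.g n ≤ a₁ ∧ B₃ * (cR * epsOfRecord ν S.flow.g n) ≤ ν.εreg)
    (ha₀ : ν.εreg ≤ a₀) (hcomp : ∀ n, n < k → cR * epsOfRecord ν S.flow.g n ≤ 2 * (cR * epsOfRecord ν S.flow.g (n + 1)))
    (hcomp' : ∀ n, n < k → cR * epsOfRecord ν S.flow.g (n + 1) ≤ 2 * (cR * epsOfRecord ν S.flow.g n))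
    (hα : ∀ n, 1 ≤ n → n ≤ k → 0 < S.lf.alpha0 (S.flow.g n) ∧ 0 < S.lf.alpha1 (S.flow.g n))
    (hBα : ∀ n, 1 ≤ n → n ≤ k → B₃ * (cR * epsOfRecord ν S.flow.g n) ≤ (1 - S.βc) * S.lf.alpha0 (S.flow.g n))
    (htI : ∀ n, 1 ≤ n → n ≤ k → B₃' * (cR * epsOfRecord ν S.flow.g n) ≤ S.cB * S.lf.alpha0 (S.flow.g n))
    (htMS : ∀ n, 1 ≤ n → n ≤ k → B₃' * (cR * epsOfRecord ν S.flow.g n) ≤ S.B * S.C * S.Mr * S.lf.alpha0 (S.flow.g n))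
    (hC1 : ∀ j, 1 ≤ j → j ≤ k → ∃ t : ℕ, 0 < t ∧ RkOfRecord (F.P K).L ν.r (S.flow.g j) = (F.P K).L * t)
    (hC2 : ∀ j, 1 ≤ j → j ≤ k → dCubeSide (F.P K).L M (RkOfRecord (F.P K).L ν.r (S.flow.g j)) j ∣ (F.P K).sitesPerDir 0)
    (hsN : ∀ n, 1 ≤ n → n ≤ k + 1 → ((B14.Eq213MaximalDomains.side (F.P K).L M n : ℕ) : ℤ) < (F.P K).sitesPerDir 0)
    (s : SeqOfRecord F ν M S.flow.g K k) (hsep : Sect2.SeqSeparated ν.M₁ s) (hM₁ : 0 < ν.M₁) (hc : c ≤ ν.M₁) {W : MSField (F.P K) (SU N)}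
    (h7 : Sect2.DataSmall7PTop (avOfRecord F N K) s.Ω (Sup ν K s.Ω) k (fun n => cR * epsOfRecord ν S.flow.g n) W)
    {U₀ : GaugeField (F.P K) 0 (SU N)} (hmin : IsMinimizer (avOfRecord F N K)
      {U | (∀ n, n ≤ k → PlaqSmallOn (Sect2.omegaPlaqsTop s.Ω (Sup ν K s.Ω) n) (ν.εreg * (F.P K).eta n ^ 2) U) ∧
        Sect2.CoDivClassOnTop s.Ω (Sup ν K s.Ω) k ν.εreg U} (genSet s.Ω k) W U₀) :
    ∀ j, 1 ≤ j → j ≤ k → ∀ X : (Sect2.domSys (F.P K) M j).Dom,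
      (Sect2.domSites (F.P K) M j X ⊆ s.Λ j →
        Sect2.ofBackgroundC S.ι (U₀) ∈
          Sect2.spaceI S (Sect2.Residual.unit (F.P K) (MatA N)) M j (Sect2.domSites (F.P K) M j X) (S.lf.alpha0 (S.flow.g j)) (S.lf.alpha1 (S.flow.g j))) ∧
      (Sect2.admB (F.P K) ν M S.flow.g s.Ω s.Λ j (Sect2.domSites (F.P K) M j X) = true →
        Sect2.ofBackgroundC S.ι (U₀) ∈
          Sect2.spaceMS S (Sect2.Residual.unit (F.P K) (MatA N)) M j (Sect2.domSites (F.P K) M j X) s.Ω) := by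
  have hplaq := plaqSmallOn_of_thm1RegSepTop7M h15 ν M S.flow.g K k cR s hsep hM₁ hnum ha₀ hcomp hcomp' h7 hmin
  have hclass : ∀ n, 1 ≤ n → n ≤ k → PlaqSmallOn (omegaPlaqs s.Ω n) (B₃ * (cR * epsOfRecord ν S.flow.g n) * (F.P K).eta n ^ 2) U₀ := by
    intro n hn1 hnk
    have := hplaq n hnk
    rwa [Sect2.omegaPlaqsTop_of_ne_zero _ _ (Nat.one_le_iff_ne_zero.mp hn1)] at this
  have hg := localGaugeOn_of_thm1GaugeRegSepTop7MR h15G ν S.flow.g K k cR s hsep hM₁ hc hnum ha₀ hcomp hcomp' h7 hmin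
  exact bgRowAtDatumU_of_classBoundsPos_of_localGauge S hι h𝓜 hS hpos ν hM K k s U₀ hclass hα hBα htI htMS hC1 hC2
    (fun n hn1 hnk => (hg n hn1 hnk).1 (hsN n hn1 (by omega))) (fun n hn1 hnk => (hg n hn1 hnk).2 (hsN (n + 1) (by omega) (by omega)))

end RowBodyGaugeR

/-! ## §3  The R gauge sentence AT THE SUPPORT OF RECORD and the suppliers at node00-def-R's `UbgMSCoPOfRecord … s 𝐖` -/

section AtRecordGaugeCoPMR

variable (F : T4Family) (N : ℕ) [NeZero N]

/-- **★★ NAMED FACT, `CoP` EDITION, R-PORT — [15] THEOREM 1 (9) LINE 1 IN ∃-GAUGE FORM OVER CLASS (6) ON THE SUPPORT OF RECORD `suppDomOfRecord`, `M₁ ≥ 1`, SEPARATION FLOOR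
`c ≤ M₁`, CUBE LETTER `M`**: §1's `VariationalThm1GaugeRegSepTop7MR` at the selector `Sup := suppDomOfRecord` (definitional).  A `Prop` with parameters, NEVER asserted.
-- TODO(general form): as §1.
[cite: Balaban1985Variational, (1) p.277, Thm 1 (2),(3),(5),(6),(7),(9) pp.278–279, (144)–(152) pp.300–301; Balaban1985RegularSpaces, (1.3)–(1.9) p.77, Prop. 6 p.99; Balaban1988Convergent, (2.6)–(2.8) pp.255–256, (2.12)–(2.13) p.256, (2.27)–(2.28) p.259, (2.38) p.261] -/
def VariationalThm1GaugeRegSepCoP7MR (M c : ℕ) (B₃ B₃' a₀ a₁ : ℝ) : Prop :=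
  VariationalThm1GaugeRegSepTop7MR F N (fun ν K Ω => suppDomOfRecord F ν K Ω) M c B₃ B₃' a₀ a₁

variable {F N}

/-- Definitional bridge to the R top-domain sentence at the selector of record. [cite: Balaban1985Variational, Thm 1 (9) p.279 (bookkeeping)] -/
theorem VariationalThm1GaugeRegSepCoP7MR.toTop7MR {M c : ℕ} {B₃ B₃' a₀ a₁ : ℝ} (h : VariationalThm1GaugeRegSepCoP7MR F N M c B₃ B₃' a₀ a₁) :
    VariationalThm1GaugeRegSepTop7MR F N (fun ν K Ω => suppDomOfRecord F ν K Ω) M c B₃ B₃' a₀ a₁ := h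

/-- Conversely (definitional). [cite: Balaban1985Variational, Thm 1 (9) p.279 (bookkeeping)] -/
theorem VariationalThm1GaugeRegSepTop7MR.toCoP7MR {M c : ℕ} {B₃ B₃' a₀ a₁ : ℝ}
    (h : VariationalThm1GaugeRegSepTop7MR F N (fun ν K Ω => suppDomOfRecord F ν K Ω) M c B₃ B₃' a₀ a₁) : VariationalThm1GaugeRegSepCoP7MR F N M c B₃ B₃' a₀ a₁ := h

/-- OLD ⇒ NEW at the selector of record. [cite: Balaban1985Variational, Thm 1 (9) p.279 (bookkeeping)] -/
theorem VariationalThm1GaugeRegSepCoP7M.toR {M : ℕ} {B₃ B₃' a₀ a₁ : ℝ} (h : VariationalThm1GaugeRegSepCoP7M F N M B₃ B₃' a₀ a₁) (c : ℕ) :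
    VariationalThm1GaugeRegSepCoP7MR F N M c B₃ B₃' a₀ a₁ :=
  VariationalThm1GaugeRegSepTop7M.toR h c

/-- The R gauge `CoP` sentence is ANTITONE in `a₀`, `a₁`. [cite: Balaban1985Variational, Thm 1 p.279 (the range «ε₀ ≤ a₀», «ε₁ ≤ a₁»)] -/
theorem VariationalThm1GaugeRegSepCoP7MR.of_le {M c : ℕ} {B₃ B₃' a₀ a₀' a₁ a₁' : ℝ} (h : VariationalThm1GaugeRegSepCoP7MR F N M c B₃ B₃' a₀ a₁) (ha₀ : a₀' ≤ a₀) (ha₁ : a₁' ≤ a₁) :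
    VariationalThm1GaugeRegSepCoP7MR F N M c B₃ B₃' a₀' a₁' :=
  VariationalThm1GaugeRegSepTop7MR.of_le h ha₀ ha₁

/-- The R gauge `CoP` sentence is MONOTONE in `B₃'`. [cite: Balaban1985Variational, Thm 1 (9) p.279 (bookkeeping)] -/
theorem VariationalThm1GaugeRegSepCoP7MR.mono {M c : ℕ} {B₃ B₃' B₃'' a₀ a₁ : ℝ} (h : VariationalThm1GaugeRegSepCoP7MR F N M c B₃ B₃' a₀ a₁) (hB : B₃' ≤ B₃'') :
    VariationalThm1GaugeRegSepCoP7MR F N M c B₃ B₃'' a₀ a₁ :=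
  VariationalThm1GaugeRegSepTop7MR.mono h hB

/-- The R gauge `CoP` sentence is MONOTONE in the floor. [cite: Balaban1985RegularSpaces, (1.3)–(1.6) p.77 (bookkeeping)] -/
theorem VariationalThm1GaugeRegSepCoP7MR.mono_floor {M c c' : ℕ} {B₃ B₃' a₀ a₁ : ℝ} (h : VariationalThm1GaugeRegSepCoP7MR F N M c B₃ B₃' a₀ a₁) (hc : c ≤ c') :
    VariationalThm1GaugeRegSepCoP7MR F N M c' B₃ B₃' a₀ a₁ :=
  VariationalThm1GaugeRegSepTop7MR.mono_floor h hc

/-- **★ def-R's COLLAR-CLASS BACKGROUND `UbgMSCoPOfRecord … s 𝐖` CARRIES THE LOCAL GAUGES OF (9) LINE 1 AT THRESHOLD `B₃'·cR·ε_n` ON BOTH CUBE FAMILIES INSIDE `Ω_n`, `1 ≤ n ≤ k`, ON THE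
SOLVABLE SET**, at numerics meeting the floor (`hc : c ≤ ν.M₁`) — FILE 14's `localGaugeOn_UbgMSCoPOfRecord_of_thm1GaugeRegSepCoP7M`, floor threaded.
[cite: Balaban1985Variational, Thm 1 (2),(6),(7),(9) pp.278–279; Balaban1985RegularSpaces, (1.3) p.77; Balaban1988Convergent, (2.6)–(2.8) pp.255–256, (2.12)–(2.13) p.256, (2.38) p.261] -/
theorem localGaugeOn_UbgMSCoPOfRecord_of_thm1GaugeRegSepCoP7MR {M c : ℕ} {B₃ B₃' a₀ a₁ : ℝ} (h15G : VariationalThm1GaugeRegSepCoP7MR F N M c B₃ B₃' a₀ a₁)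
    (ν : Stage7Numerics) (g : ℕ → ℝ) (K k : ℕ) (cR : ℝ) (s : SeqOfRecord F ν M g K k) (hsep : Sect2.SeqSeparated ν.M₁ s) (hM₁ : 0 < ν.M₁) (hc : c ≤ ν.M₁)
    (hnum : ∀ n, n ≤ k → 0 < cR * epsOfRecord ν g n ∧ cR * epsOfRecord ν g n ≤ a₁ ∧ B₃ * (cR * epsOfRecord ν g n) ≤ ν.εreg) (ha₀ : ν.εreg ≤ a₀)
    (hcomp : ∀ n, n < k → cR * epsOfRecord ν g n ≤ 2 * (cR * epsOfRecord ν g (n + 1)))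
    (hcomp' : ∀ n, n < k → cR * epsOfRecord ν g (n + 1) ≤ 2 * (cR * epsOfRecord ν g n))
    {W : MSField (F.P K) (SU N)} (h7 : Sect2.DataSmall7PTop (avOfRecord F N K) s.Ω (suppDomOfRecord F ν K s.Ω) k (fun n => cR * epsOfRecord ν g n) W)
    (hsol : W ∈ solvableDom (avOfRecord F N K) (regMSCoPOfRecord F N ν K k s.Ω) (genSet s.Ω k)) :
    ∀ n, 1 ≤ n → n ≤ k →
      (((B14.Eq213MaximalDomains.side (F.P K).L M n : ℕ) : ℤ) < (F.P K).sitesPerDir 0 →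
        ∀ a ∈ cubeIndices (F.P K) (B14.Eq213MaximalDomains.side (F.P K).L M n),
          cubeEnl (F.P K) (B14.Eq213MaximalDomains.side (F.P K).L M n) a 0 ⊆ s.Ω n →
          Sect2.LocalGaugeOn (cubeEnl (F.P K) (B14.Eq213MaximalDomains.side (F.P K).L M n) a 0) ((F.P K).eta n) (B₃' * (cR * epsOfRecord ν g n))
            (UbgMSCoPOfRecord F N ν M g K k s W)) ∧
      (((B14.Eq213MaximalDomains.side (F.P K).L M (n + 1) : ℕ) : ℤ) < (F.P K).sitesPerDir 0 →
        ∀ a ∈ cubeIndices (F.P K) (B14.Eq213MaximalDomains.side (F.P K).L M (n + 1)),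
          cubeEnl (F.P K) (B14.Eq213MaximalDomains.side (F.P K).L M (n + 1)) a 0 ⊆ s.Ω n →
          Sect2.LocalGaugeOn (cubeEnl (F.P K) (B14.Eq213MaximalDomains.side (F.P K).L M (n + 1)) a 0) ((F.P K).eta n) (B₃' * (cR * epsOfRecord ν g n))
            (UbgMSCoPOfRecord F N ν M g K k s W)) :=
  localGaugeOn_of_thm1GaugeRegSepTop7MR h15G ν g K k cR s hsep hM₁ hc hnum ha₀ hcomp hcomp' h7 (isMinimizer_UbgMSCoPOfRecord ν M g K k s hsol)

/-- **★★★ ROW P11's BODY AT `(s, 𝐖)` FOR def-R's COLLAR-CLASS MINIMISER `UbgMSCoPOfRecord … s 𝐖`, FROM (8) `VariationalThm1RegSepCoP7M` AND THE R GAUGE `CoP` SENTENCE, at numerics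
meeting the floor (`hc : c ≤ ν.M₁`)** — FILE 14's `bgRowAtDatumCoP_of_thm1RegSepCoP7M_of_thm1Gauge`, floor threaded; on the solvable set §2's ★★★ at `isMinimizer_UbgMSCoPOfRecord`, off it
the junk `1` by `bgRowAtDatum_one`.  The shape FILE B's closers key on. [cite: Balaban1985Variational, Thm 1 (2),(6)–(9) pp.278–279; Balaban1988Convergent, (2.6)–(2.8) pp.255–256, (2.12)–(2.13) p.256, (2.27)–(2.28) p.259, (2.34)–(2.41) p.261; Balaban1987RG1, (1.11)–(1.16) p.262] -/
theorem bgRowAtDatumCoP_of_thm1RegSepCoP7M_of_thm1GaugeR {M c : ℕ} {B₃ B₃' a₀ a₁ : ℝ} (h15 : VariationalThm1RegSepCoP7M F N B₃ a₀ a₁)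
    (h15G : VariationalThm1GaugeRegSepCoP7MR F N M c B₃ B₃' a₀ a₁)
    (S : Sect2.Setting (MatA N) (SU N)) (hι : S.ι = ιSU N) (h𝓜 : S.𝓜 = B12RegularSpaces111SpecialUnitary.suModel N) (hS : S.Laws) (hpos : S.Pos)
    (ν : Stage7Numerics) (hM : 0 < M) (K k : ℕ) (cR : ℝ)
    (hnum : ∀ n, n ≤ k → 0 < cR * epsOfRecord ν S.flow.g n ∧ cR * epsOfRecord ν S.flow.g n ≤ a₁ ∧ B₃ * (cR * epsOfRecord ν S.flow.g n) ≤ ν.εreg)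
    (ha₀ : ν.εreg ≤ a₀) (hcomp : ∀ n, n < k → cR * epsOfRecord ν S.flow.g n ≤ 2 * (cR * epsOfRecord ν S.flow.g (n + 1)))
    (hcomp' : ∀ n, n < k → cR * epsOfRecord ν S.flow.g (n + 1) ≤ 2 * (cR * epsOfRecord ν S.flow.g n))
    (hα : ∀ n, 1 ≤ n → n ≤ k → 0 < S.lf.alpha0 (S.flow.g n) ∧ 0 < S.lf.alpha1 (S.flow.g n))
    (hBα : ∀ n, 1 ≤ n → n ≤ k → B₃ * (cR * epsOfRecord ν S.flow.g n) ≤ (1 - S.βc) * S.lf.alpha0 (S.flow.g n))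
    (htI : ∀ n, 1 ≤ n → n ≤ k → B₃' * (cR * epsOfRecord ν S.flow.g n) ≤ S.cB * S.lf.alpha0 (S.flow.g n))
    (htMS : ∀ n, 1 ≤ n → n ≤ k → B₃' * (cR * epsOfRecord ν S.flow.g n) ≤ S.B * S.C * S.Mr * S.lf.alpha0 (S.flow.g n))
    (hC1 : ∀ j, 1 ≤ j → j ≤ k → ∃ t : ℕ, 0 < t ∧ RkOfRecord (F.P K).L ν.r (S.flow.g j) = (F.P K).L * t)
    (hC2 : ∀ j, 1 ≤ j → j ≤ k → dCubeSide (F.P K).L M (RkOfRecord (F.P K).L ν.r (S.flow.g j)) j ∣ (F.P K).sitesPerDir 0)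
    (hsN : ∀ n, 1 ≤ n → n ≤ k + 1 → ((B14.Eq213MaximalDomains.side (F.P K).L M n : ℕ) : ℤ) < (F.P K).sitesPerDir 0)
    (s : SeqOfRecord F ν M S.flow.g K k) (hsep : Sect2.SeqSeparated ν.M₁ s) (hM₁ : 0 < ν.M₁) (hc : c ≤ ν.M₁) (W : MSField (F.P K) (SU N))
    (h7 : Sect2.DataSmall7PTop (avOfRecord F N K) s.Ω (suppDomOfRecord F ν K s.Ω) k (fun n => cR * epsOfRecord ν S.flow.g n) W) :
    ∀ j, 1 ≤ j → j ≤ k → ∀ X : (Sect2.domSys (F.P K) M j).Dom,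
      (Sect2.domSites (F.P K) M j X ⊆ s.Λ j →
        Sect2.ofBackgroundC S.ι (UbgMSCoPOfRecord F N ν M S.flow.g K k s W) ∈
          Sect2.spaceI S (Sect2.Residual.unit (F.P K) (MatA N)) M j (Sect2.domSites (F.P K) M j X) (S.lf.alpha0 (S.flow.g j)) (S.lf.alpha1 (S.flow.g j))) ∧
      (Sect2.admB (F.P K) ν M S.flow.g s.Ω s.Λ j (Sect2.domSites (F.P K) M j X) = true →
        Sect2.ofBackgroundC S.ι (UbgMSCoPOfRecord F N ν M S.flow.g K k s W) ∈
          Sect2.spaceMS S (Sect2.Residual.unit (F.P K) (MatA N)) M j (Sect2.domSites (F.P K) M j X) s.Ω) := by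
  by_cases hsol : W ∈ solvableDom (avOfRecord F N K) (regMSCoPOfRecord F N ν K k s.Ω) (genSet s.Ω k)
  · exact bgRowAtDatumU_of_thm1RegSepTop7M_of_thm1GaugeR h15 h15G S hι h𝓜 hS hpos ν hM K k cR hnum ha₀ hcomp hcomp' hα hBα htI htMS hC1 hC2 hsN s hsep hM₁ hc h7
      (isMinimizer_UbgMSCoPOfRecord ν M S.flow.g K k s hsol)
  · rw [UbgMSCoPOfRecord_eq_one_of_not_mem ν M S.flow.g K k s hsol]
    exact bgRowAtDatum_one S hpos ν M K k s hα

end AtRecordGaugeCoPMR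

/-! ## §4  The R gauge sentence FROM dag-n07-e's floor-carrying STEP fact `Gauge9RegSepTopStepR` — minimal ⇒ critical -/

section FromStepR

variable {F : T4Family} {N : ℕ} [NeZero N]

/-- **★ THE R GAUGE TOP-DOMAIN SENTENCE FROM THE R STEP FACT**: dag-n07-e's `Gauge9RegSepTopStepR F N Sup M c B₃ B₃' a₀ a₁` (`Node00.TorusCoverGaugeTokensR`, p546637: [15] Sect. F for (9)
line 1 at the objects of record, for configurations in class (6)-Top that are CRITICAL on the fibre, `1 ≤ k`, floor `c ≤ ν.M₁`) gives §1's sentence for every MINIMISER — minimal over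
the open class ⇒ critical on the fibre (`isCritOnFibre_of_isMinimizer_classTop`, Fermat); the floor is threaded.  FILE 14 §4's pattern. [cite: Balaban1985Variational, Thm 1 (9) p.279, p.299, p.300, Prop. 8 p.304, (152) p.301, (167)–(169) pp.304–305; Balaban1988Convergent, (2.12)–(2.13) p.256] -/
theorem variationalThm1GaugeRegSepTop7MR_of_gauge9TopStepR {Sup : (ν : Stage7Numerics) → (K : ℕ) → (ℕ → Set (Site (F.P K) 0)) → Set (Site (F.P K) 0)} {M c : ℕ}
    {B₃ B₃' a₀ a₁ : ℝ} (h9 : Gauge9RegSepTopStepR F N Sup M c B₃ B₃' a₀ a₁) : VariationalThm1GaugeRegSepTop7MR F N Sup M c B₃ B₃' a₀ a₁ :=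
  fun ν g K k s hsep hM₁ hc ε₀ δ hδ hcomp hcomp' hε₀ W h7 U₀ hU₀ _ hn1 hnk =>
    ⟨fun hSN a ha hΩ => h9 ν g K k s hsep hM₁ hc (hn1.trans hnk) ε₀ δ hδ hcomp hcomp' hε₀ W h7 U₀ hU₀.1.1 hU₀.1.2 hU₀.2.1
        (isCritOnFibre_of_isMinimizer_classTop hU₀) _ hn1 hnk _ (Or.inl rfl) hSN a ha hΩ,
     fun hSN a ha hΩ => h9 ν g K k s hsep hM₁ hc (hn1.trans hnk) ε₀ δ hδ hcomp hcomp' hε₀ W h7 U₀ hU₀.1.1 hU₀.1.2 hU₀.2.1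
        (isCritOnFibre_of_isMinimizer_classTop hU₀) _ hn1 hnk _ (Or.inr rfl) hSN a ha hΩ⟩

/-- **★ THE R GAUGE `CoP` SENTENCE FROM THE R STEP FACT** at def-R's support selector (definitional). [cite: Balaban1985Variational, Thm 1 (9) p.279, Prop. 8 p.304, (152) p.301] -/
theorem variationalThm1GaugeRegSepCoP7MR_of_gauge9TopStepR {M c : ℕ} {B₃ B₃' a₀ a₁ : ℝ}
    (h9 : Gauge9RegSepTopStepR F N (fun ν K Ω => suppDomOfRecord F ν K Ω) M c B₃ B₃' a₀ a₁) : VariationalThm1GaugeRegSepCoP7MR F N M c B₃ B₃' a₀ a₁ :=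
  (variationalThm1GaugeRegSepTop7MR_of_gauge9TopStepR h9).toCoP7MR

end FromStepR

/-! ## §5  The Stage-13 lift with the floor as a witness fact `hc : c ≤ θ.ν.M₁` (FILE 21 §2's twin) -/

section LiftGaugeR

variable {F : T4Family} {N : ℕ} [NeZero N]

/-- **★ ROW P11's BODY AT `UbgMSCoPOfRecord … n s 𝐖` AT THE STAGE-13 RECORD FROM (8) `VariationalThm1RegSepCoP7M` AND THE R GAUGE `CoP` SENTENCE AT CUBE LETTER `θ.τ9.M` AND FLOOR
`c`, FOR A PARAMETER MEETING THE FLOOR (`hc : c ≤ θ.ν.M₁`)** — node00-def-K0a's `Stage13Params.bgAtDatumCoP_of_thm1RegSepCoP7M_of_thm1Gauge` (FILE 21 §2) with the floor threaded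
to §3's ★★★; every other letter as there (laws∕`Pos`∕radii from admissibility in the window, (C2) = `PartCompat₁₃`).  A REDUCTION — the two sentences are hypotheses, never asserted.
[cite: Balaban1985Variational, (6)–(7) p.278, Thm 1 (8)–(9) p.279, (152) p.301, Prop. 8 p.304; Balaban1985RegularSpaces, (1.3)–(1.9) p.77, Prop. 6 p.99; Balaban1988Convergent, Thm 1 p.262, (2.4)–(2.8) pp.255–256, (2.12)–(2.13) p.256, (2.27)–(2.28) p.259, (2.34)–(2.41) p.261, (3.16)–(3.22) pp.268–269; Balaban1987RG1, (1.11)–(1.12) p.262; Balaban1989LargeFieldI, (0.3)–(0.4) p.176] -/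
theorem Stage13Params.bgAtDatumCoP_of_thm1RegSepCoP7M_of_thm1GaugeR (θ : Stage13Params F N) (hθ : θ.Admissible F N) (hRz : θ.Rz = RzOfRecord F N)
    {c : ℕ} {B₃ B₃' a₀ a₁ : ℝ} (hM : 0 < θ.τ9.M) (hc : c ≤ θ.ν.M₁)
    (h15 : VariationalThm1RegSepCoP7M F N B₃ a₀ a₁) (h15G : VariationalThm1GaugeRegSepCoP7MR F N θ.τ9.M c B₃ B₃' a₀ a₁)
    (hnum : ∀ (p : B12.RunParams) (n : ℕ), n ≤ p.K → Step.InInterval θ.γ n (gOfRecord₁₃ F N θ p) → ∀ m, m ≤ n →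
      0 < θ.s2.cR * epsOfRecord θ.ν (gOfRecord₁₃ F N θ p) m ∧ θ.s2.cR * epsOfRecord θ.ν (gOfRecord₁₃ F N θ p) m ≤ a₁ ∧ B₃ * (θ.s2.cR * epsOfRecord θ.ν (gOfRecord₁₃ F N θ p) m) ≤ θ.ν.εreg)
    (ha₀ : θ.ν.εreg ≤ a₀)
    (hcomp : ∀ (p : B12.RunParams) (n : ℕ), n ≤ p.K → Step.InInterval θ.γ n (gOfRecord₁₃ F N θ p) → ∀ m, m < n →
      θ.s2.cR * epsOfRecord θ.ν (gOfRecord₁₃ F N θ p) m ≤ 2 * (θ.s2.cR * epsOfRecord θ.ν (gOfRecord₁₃ F N θ p) (m + 1)))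
    (hcomp' : ∀ (p : B12.RunParams) (n : ℕ), n ≤ p.K → Step.InInterval θ.γ n (gOfRecord₁₃ F N θ p) → ∀ m, m < n →
      θ.s2.cR * epsOfRecord θ.ν (gOfRecord₁₃ F N θ p) (m + 1) ≤ 2 * (θ.s2.cR * epsOfRecord θ.ν (gOfRecord₁₃ F N θ p) m))
    (hBα : ∀ (p : B12.RunParams) (n : ℕ), n ≤ p.K → Step.InInterval θ.γ n (gOfRecord₁₃ F N θ p) → ∀ m, 1 ≤ m → m ≤ n →
      B₃ * (θ.s2.cR * epsOfRecord θ.ν (gOfRecord₁₃ F N θ p) m) ≤ (1 - θ.s2.βc) * (lfOfRecord₁₂ F N θ.toStage12Params).alpha0 (gOfRecord₁₃ F N θ p m))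
    (htI : ∀ (p : B12.RunParams) (n : ℕ), n ≤ p.K → Step.InInterval θ.γ n (gOfRecord₁₃ F N θ p) → ∀ m, 1 ≤ m → m ≤ n →
      B₃' * (θ.s2.cR * epsOfRecord θ.ν (gOfRecord₁₃ F N θ p) m) ≤ θ.s2.cB * (lfOfRecord₁₂ F N θ.toStage12Params).alpha0 (gOfRecord₁₃ F N θ p m))
    (htMS : ∀ (p : B12.RunParams) (n : ℕ), n ≤ p.K → Step.InInterval θ.γ n (gOfRecord₁₃ F N θ p) → ∀ m, 1 ≤ m → m ≤ n →
      B₃' * (θ.s2.cR * epsOfRecord θ.ν (gOfRecord₁₃ F N θ p) m) ≤ θ.s2.B * θ.s2.C * θ.s2.Mr * (lfOfRecord₁₂ F N θ.toStage12Params).alpha0 (gOfRecord₁₃ F N θ p m))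
    (hC1 : ∀ (p : B12.RunParams) (n : ℕ), n ≤ p.K → Step.InInterval θ.γ n (gOfRecord₁₃ F N θ p) → ∀ j, 1 ≤ j → j ≤ n →
      ∃ t : ℕ, 0 < t ∧ RkOfRecord (F.P p.K).L θ.ν.r (gOfRecord₁₃ F N θ p j) = (F.P p.K).L * t)
    (hsN : ∀ (p : B12.RunParams) (n : ℕ), n ≤ p.K → ∀ n', 1 ≤ n' → n' ≤ n + 1 →
      ((B14.Eq213MaximalDomains.side (F.P p.K).L θ.τ9.M n' : ℕ) : ℤ) < (F.P p.K).sitesPerDir 0) :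
    ∀ (p : B12.RunParams) (n : ℕ), n ≤ p.K → Step.InInterval θ.γ n (gOfRecord₁₃ F N θ p) → PartCompat₁₃ F N θ p n →
      ∀ s : SeqOfRecord F θ.ν θ.τ9.M (gOfRecord₁₃ F N θ p) p.K n, Sect2.SeqSeparated θ.ν.M₁ s → 0 < θ.ν.M₁ → ∀ W : MSField (F.P p.K) (SU N),
      Sect2.DataSmall7PTop (avOfRecord F N p.K) s.Ω (suppDomOfRecord F θ.ν p.K s.Ω) n (fun j => θ.s2.cR * epsOfRecord θ.ν (gOfRecord₁₃ F N θ p) j) W →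
      ∀ j, 1 ≤ j → j ≤ n → ∀ X : (Sect2.domSys (F.P p.K) θ.τ9.M j).Dom,
      (Sect2.domSites (F.P p.K) θ.τ9.M j X ⊆ s.Λ j →
        Sect2.ofBackgroundC (settingOfRecord₁₃ F N θ p).ι (UbgMSCoPOfRecord F N θ.ν θ.τ9.M (gOfRecord₁₃ F N θ p) p.K n s W) ∈
          Sect2.spaceI (settingOfRecord₁₃ F N θ p) (θ.Rz p.K) θ.τ9.M j (Sect2.domSites (F.P p.K) θ.τ9.M j X)
            ((settingOfRecord₁₃ F N θ p).lf.alpha0 ((settingOfRecord₁₃ F N θ p).flow.g j)) ((settingOfRecord₁₃ F N θ p).lf.alpha1 ((settingOfRecord₁₃ F N θ p).flow.g j))) ∧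
      (Sect2.admB (F.P p.K) θ.ν θ.τ9.M (gOfRecord₁₃ F N θ p) s.Ω s.Λ j (Sect2.domSites (F.P p.K) θ.τ9.M j X) = true →
        Sect2.ofBackgroundC (settingOfRecord₁₃ F N θ p).ι (UbgMSCoPOfRecord F N θ.ν θ.τ9.M (gOfRecord₁₃ F N θ p) p.K n s W) ∈
          Sect2.spaceMS (settingOfRecord₁₃ F N θ p) (θ.Rz p.K) θ.τ9.M j (Sect2.domSites (F.P p.K) θ.τ9.M j X) s.Ω) := by
  intro p n hn hw hpc s hsep hM₁ W h7
  rw [hRz]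
  exact bgRowAtDatumCoP_of_thm1RegSepCoP7M_of_thm1GaugeR h15 h15G (settingOfRecord₁₃ F N θ p) rfl rfl (settingOfRecord₁₃_laws F N θ p)
    (settingOfRecord₁₃_pos F N θ hθ.1.pos p) θ.ν hM p.K n θ.s2.cR (hnum p n hn hw) ha₀ (hcomp p n hn hw) (hcomp' p n hn hw)
    (fun m _ hm => alphaPos₁₃_of_inInterval hθ hw hm) (hBα p n hn hw) (htI p n hn hw) (htMS p n hn hw) (hC1 p n hn hw) hpc (hsN p n hn) s hsep hM₁ hc W h7

end LiftGaugeR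

end Literature.MathematicalPhysics.QuantumFieldTheory.Balaban1983to89.Node00

end
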